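/-
Copyright: the b2b-balaban T⁴-continuum CRUX team, row NE7b, leaf lineage `t4-ne7b-formalise-leaf-02` (gen 133). Project licence.
-/
import Literature.MathematicalPhysics.QuantumFieldTheory.Balaban1983to89.B7TranslationCovariance
import Literature.MathematicalPhysics.QuantumFieldTheory.Balaban1983to89.T4TermwiseTorus

/-!
# THE ONE-STEP LINEAR AVERAGES OF PERIODIC DATA LIVE ON THE COARSE TORUS: translation covariance of (125)'s main part `Q₀` and of
# the rotated sums `(R_{0,y}A)(Γ)`, `LM`-periodicity of `Q₀A`, `L(Q(V₀)A)`, `(R_{0,·}A)(Γ)`, `V̄₀` for `LM`-periodic `(V₀, A)`, descent of the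
# fine data to the torus `(ℤ∕LM)^d`, and the two-scale WRAP lemma `F(L·(y + e_κ)) = F(L·y + L e_κ)` on `(ℤ∕M)^d`
# (row NE7b, node U5c; E-side key reading — the dictionary that puts this lineage's `k = 1` chain, typed on [B7]'s `ℤ^d` objects, on the
# two-scale torus of `…OneStepCoarseCurlL2`: its characterising hypotheses `hF`, `hA`, `hXv` are INHABITED for periodic data)

Cell `pub-balaban`, sub-cell `t4`, spine estimate NE7b (`T4WeightBudget.RelWeightBound`; the cell's OWN estimate — NOT PRINTED in
[Bałaban 1983–89], NOT PROVED).  Crux-route work under `Spine/NE7b/` by the row's E-side ∕ key-readings ∕ lattice-geometry leaf lineage; a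
[folklore] dictionary BY NAME over two Literature modules with hub oleans (`…B7TranslationCovariance`: `hol_shiftCfg`, `stepHol_shiftCfg`,
`bavg_shiftCfg`, `linQcov_shiftCfg` — the joint translation covariance of [B7]'s one-step objects; `…T4TermwiseTorus`: `IsPeriodic`, `tcls`,
`tlift`, `IsPeriodic.descends`, `IsPeriodic.bavg`, `IsPeriodic.hol`); NOTHING of Bałaban's is asserted beyond what those modules prove; no
`T4Continuum/Support` leaf typed; no `def`, no notation, no instance; zero `sorry`.

WHY (located).  `…OneStepCoarseCurlL2.sum_sq_coarseCurl_le` (p388049) is stated for `ℤ^d` data `(V₀, A)` read through torus-indexed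
functions `Fq`, `Ab`, `Xv` characterised by hypotheses (`hF : Fq (tcls (LM) y, a) = ‖(R_{0,y}A)(∂p_a)‖`, `hA : Ab (tcls (LM) y, ν) = ‖A(y,ν)‖`,
`hXv` at the block base points `qb y = L·y`, `y ∈ (ℤ∕M)^d`), and its coarse curl reads the averaged field at `qb y + L e_κ` — a `ℤ^d`
neighbour, which is the torus neighbour `qb (y + e_κ)` only up to a period `LM e_κ` (when `y_κ = M − 1`).  To read that END as the `hM`
letter of `…AveragedCurlFormSplit.curlForm_letter_of_split` on TORUS coarse 1-forms one needs: (i) that `Q₀A`, `L(Q(V₀)A)`, `V̄₀` and the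
fine curls of `LM`-periodic `(V₀, A)` are `LM`-periodic (so functions of the class), (ii) that the hypotheses `hF`, `hA` are inhabited, and
(iii) the wrap identity.  All three are bookkeeping over the cited modules; this file records them once, for the junction files of this
lineage (`…OneStepRemainderTorus`, `…OneStepCurlFormDisplay`).

WHAT IS PROVED ([folklore]):
* §1 joint translation covariance, supplementing `…B7TranslationCovariance` BY NAME (there: `Qcov`, `linQcov`, `Ccov`; here the two
  objects of (125) it does not list): `tstep_shiftCfg`, **`tsum_shiftCfg`** (`(R_{0,x}(t_aA))_{t_aV₀}(Γ) = (R_{0,x+a}A)_{V₀}(Γ)`),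
  **`Q0cov_shiftCfg`** (`Q₀(t_aV₀, t_aA)_c = Q₀(V₀, A)_{c+a}`).
* §2 periodicity (`T4TermwiseTorus.IsPeriodic T`, any period `T`): `shiftCfg_eq_of_isPeriodic`, **`isPeriodic_tsum`**, **`isPeriodic_Q0cov`**,
  **`isPeriodic_linQcov`**, `isPeriodic_norm_apply` (the bond sizes `‖A(·,ν)‖`), `isPeriodic_norm_tsum` (the curl sizes `‖(R_{0,·}A)(Γ)‖`).
* §3 descent = the characterising hypotheses of `…OneStepCoarseCurlL2` are INHABITED for periodic data: **`exists_fineCurl_torus`**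
  (`∃ Fq, ∀ y a, Fq (tcls T y, a) = ‖(R_{0,y}A)(∂p_a)‖`), **`exists_bondSize_torus`** (`∃ Ab, ∀ y ν, Ab (tcls T y, ν) = ‖A(y,ν)‖`) —
  `IsPeriodic.descends` BY NAME.
* §4 the two-scale torus `(ℤ∕M)^d ↪ ℤ^d`, `qb y = L·y` (characterised by `hqb` verbatim as in `…OneStepCoarseCurlL2`): `qb_add_single`
  (`qb(y + e_κ) = qb y + L e_κ + LM·m` for an explicit `m ∈ ℤ^d`), **`apply_qb_add_single`** (THE WRAP LEMMA: `F(qb(y + e_κ)) = F(qb y + L e_κ)`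
  for every `LM`-periodic `F`), `tcls_qb` (the class of a base point).

NOT HERE (honest): any inequality; the (R-M) letter on the torus (`…OneStepRemainderTorus`); the (h1) display (`…OneStepCurlFormDisplay`);
`k > 1`; anything of Bałaban's ((A3) ∕ (A1c), NC-NE7b-α UNRULED).  BY-NAME EFFECT ON THE WALL: NONE (dictionary for the (h1) slot at `k = 1`;
the wall is (R2)).  NE7b NOT PRINTED ∕ NOT PROVED; spine PROVED 0∕9; rung (B)+1 on a FINITE torus — NOT infinite volume, NOT the mass gap,
NOT Clay.
HONEST DEPENDENCY: continuum YM on T⁴ ⇐ BetaPertH ∧ nine spine estimates (0/9 proved); BetaPertH ⇐ (D1) ∧ (D4) ∧ CAP+tail; G-an2-4 gates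
asym, D1 and NE2/3/4.
-/

set_option autoImplicit false

noncomputable section

open scoped BigOperators
open Literature.MathematicalPhysics.QuantumFieldTheory.Balaban1983to89.B7Prop1Explicit (Site Letter e hol stepHol seg treeWord boxVec bavg
  plaqWord)
open Literature.MathematicalPhysics.QuantumFieldTheory.Balaban1983to89.B7Eq78Linearization (conjR)
open Literature.MathematicalPhysics.QuantumFieldTheory.Balaban1983to89.B7Prop3GeneralRotated (tstep tsum tsum_cons tsum_nil)
open Literature.MathematicalPhysics.QuantumFieldTheory.Balaban1983to89.B7Prop3GeneralLinear (Q0cov linQcov)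
open Literature.MathematicalPhysics.QuantumFieldTheory.Balaban1983to89.B12Ineq417Flat (shiftCfg shiftCfg_apply stepHol_shiftCfg
  hol_shiftCfg)
open Literature.MathematicalPhysics.QuantumFieldTheory.Balaban1983to89.B7TranslationCovariance (linQcov_shiftCfg)
open Literature.MathematicalPhysics.QuantumFieldTheory.Balaban1983to89.T4TermwiseTorus (tcls tcls_apply tlift tcls_tlift IsPeriodic)

namespace Summit.QuantumFields.BalabanUV.T4Continuum.NE7b.OneStepAveragePeriodicity

variable {d : ℕ}
variable {𝔸 : Type*} [NormedRing 𝔸] [NormedAlgebra ℂ 𝔸] [CompleteSpace 𝔸]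

/-! ## §1 Joint translation covariance of the rotated sums and of (125)'s main part `Q₀` -/

section Shift

omit [NormedAlgebra ℂ 𝔸] [CompleteSpace 𝔸] in
/-- one letter of `(R_{0,x}A)(Γ)` is translation covariant jointly in `(V₀, A)`. [folklore] -/
theorem tstep_shiftCfg (a : Site d) (V₀ : Site d → Fin d → 𝔸ˣ) (A : Site d → Fin d → 𝔸) (x : Site d) (l : Letter d) :
    tstep (shiftCfg a V₀) (shiftCfg a A) x l = tstep V₀ A (x + a) l := by
  unfold tstep
  rw [stepHol_shiftCfg, shiftCfg_apply, shiftCfg_apply, add_right_comm x l.vec a]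

omit [NormedAlgebra ℂ 𝔸] [CompleteSpace 𝔸] in
/-- **THE ROTATED SUM `(R_{0,x}A)(Γ)` IS TRANSLATION COVARIANT JOINTLY IN `(V₀, A)`**: `tsum (t_aV₀) (t_aA) x Γ = tsum V₀ A (x + a) Γ` — the
companion of `…B7TranslationCovariance.tHol_shiftCfg` for the linearised transport (p. 28 after (61)). [folklore] -/
theorem tsum_shiftCfg (a : Site d) (V₀ : Site d → Fin d → 𝔸ˣ) (A : Site d → Fin d → 𝔸) :
    ∀ (x : Site d) (w : List (Letter d)), tsum (shiftCfg a V₀) (shiftCfg a A) x w = tsum V₀ A (x + a) w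
  | x, [] => by rw [tsum_nil, tsum_nil]
  | x, l :: w => by
    rw [tsum_cons, tsum_cons, tstep_shiftCfg, stepHol_shiftCfg, tsum_shiftCfg a V₀ A (x + l.vec) w, add_right_comm x l.vec a]

omit [CompleteSpace 𝔸] in
/-- **(125)'s MAIN PART `Q₀` IS TRANSLATION COVARIANT JOINTLY IN `(V₀, A)`**: `Q0cov L (t_aV₀) (t_aA) c κ = Q0cov L V₀ A (c + a) κ` — the
entry `…B7TranslationCovariance` does not list (it has `Qcov`, `linQcov`, `Ccov`). [folklore] -/
theorem Q0cov_shiftCfg (L : ℕ) (a : Site d) (V₀ : Site d → Fin d → 𝔸ˣ) (A : Site d → Fin d → 𝔸) (q : Site d) (κ : Fin d) :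
    Q0cov L (shiftCfg a V₀) (shiftCfg a A) q κ = Q0cov L V₀ A (q + a) κ := by
  unfold Q0cov
  refine Finset.sum_congr rfl fun r _ => ?_
  rw [hol_shiftCfg, tsum_shiftCfg, add_right_comm q (boxVec L r) a]

end Shift

/-! ## §2 Periodicity of the one-step objects for periodic data -/

section Periodic

variable {T : ℕ} {V₀ : Site d → Fin d → 𝔸ˣ} {A : Site d → Fin d → 𝔸}

omit [NormedAlgebra ℂ 𝔸] [CompleteSpace 𝔸] [NormedRing 𝔸] in
/-- a `T`-periodic configuration is invariant under the translations of the period lattice: `t_{T·m}F = F`. [folklore] -/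
theorem shiftCfg_eq_of_isPeriodic {β : Type*} {F : Site d → β} (hF : IsPeriodic T F) (m : Site d) :
    shiftCfg ((T : ℤ) • m) F = F :=
  funext fun x => hF x m

omit [NormedAlgebra ℂ 𝔸] [CompleteSpace 𝔸] in
/-- **the rotated sums of periodic data are periodic**: `x ↦ (R_{0,x}A)(Γ)` is `T`-periodic for `T`-periodic `(V₀, A)`. [folklore] -/
theorem isPeriodic_tsum (hV : IsPeriodic T V₀) (hA : IsPeriodic T A) (w : List (Letter d)) :
    IsPeriodic T fun x => tsum V₀ A x w := fun x m => by
  beta_reduce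
  rw [← tsum_shiftCfg ((T : ℤ) • m) V₀ A x w, shiftCfg_eq_of_isPeriodic hV, shiftCfg_eq_of_isPeriodic hA]

omit [CompleteSpace 𝔸] in
/-- **(125)'s main part of periodic data is periodic**: `Q₀A` is `T`-periodic on the coarse bonds for `T`-periodic `(V₀, A)`. [folklore] -/
theorem isPeriodic_Q0cov (L : ℕ) (hV : IsPeriodic T V₀) (hA : IsPeriodic T A) : IsPeriodic T (Q0cov L V₀ A) := fun x m => by
  funext κ
  rw [← Q0cov_shiftCfg L ((T : ℤ) • m) V₀ A x κ, shiftCfg_eq_of_isPeriodic hV, shiftCfg_eq_of_isPeriodic hA]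

/-- **the full linear one-step average (122) of periodic data is periodic**: `L(Q(V₀)A)` is `T`-periodic for `T`-periodic `(V₀, A)`
(`…B7TranslationCovariance.linQcov_shiftCfg` BY NAME). [folklore] -/
theorem isPeriodic_linQcov (L : ℕ) (hV : IsPeriodic T V₀) (hA : IsPeriodic T A) : IsPeriodic T (linQcov L V₀ A) := fun x m => by
  funext κ
  rw [← linQcov_shiftCfg L ((T : ℤ) • m) V₀ A x κ, shiftCfg_eq_of_isPeriodic hV, shiftCfg_eq_of_isPeriodic hA]

omit [NormedAlgebra ℂ 𝔸] [CompleteSpace 𝔸] in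
/-- the bond sizes `x ↦ (ν ↦ ‖A(x,ν)‖)` of a periodic 1-form are periodic. [folklore] -/
theorem isPeriodic_norm_apply (hA : IsPeriodic T A) : IsPeriodic T fun x => fun ν : Fin d => ‖A x ν‖ := fun x m => by
  beta_reduce
  rw [hA x m]

omit [NormedAlgebra ℂ 𝔸] [CompleteSpace 𝔸] in
/-- the curl sizes `x ↦ ‖(R_{0,x}A)(Γ)‖` of periodic data are periodic. [folklore] -/
theorem isPeriodic_norm_tsum (hV : IsPeriodic T V₀) (hA : IsPeriodic T A) (w : List (Letter d)) :
    IsPeriodic T fun x => ‖tsum V₀ A x w‖ := fun x m => by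
  exact congrArg _ (isPeriodic_tsum hV hA w x m)

end Periodic

/-! ## §3 Descent: the characterising hypotheses `hF`, `hA` of `…OneStepCoarseCurlL2` are inhabited for periodic data -/

section Descent

variable {T : ℕ} [NeZero T] {V₀ : Site d → Fin d → 𝔸ˣ} {A : Site d → Fin d → 𝔸}

omit [NormedAlgebra ℂ 𝔸] [CompleteSpace 𝔸] in
/-- **THE FINE CURL SIZES DESCEND TO THE TORUS**: for `T`-periodic `(V₀, A)` there is `Fq` on the torus plaquettes with
`Fq (tcls T y, a) = ‖(R_{0,y}A)(∂p_{a})‖` for every `y ∈ ℤ^d` — the hypothesis `hF` of `…OneStepCoarseCurlL2.sum_sq_coarseCurl_le` (there with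
`T = LM`). [folklore] -/
theorem exists_fineCurl_torus (hV : IsPeriodic T V₀) (hA : IsPeriodic T A) :
    ∃ Fq : (Fin d → ZMod T) × {a : Fin d × Fin d // a.1 < a.2} → ℝ,
      ∀ (y : Site d) (a : {a : Fin d × Fin d // a.1 < a.2}), Fq (tcls T y, a) = ‖tsum V₀ A y (plaqWord a.1.1 a.1.2)‖ := by
  have hper : IsPeriodic T fun y => fun a : {a : Fin d × Fin d // a.1 < a.2} => ‖tsum V₀ A y (plaqWord a.1.1 a.1.2)‖ :=
    fun y m => funext fun a => isPeriodic_norm_tsum hV hA _ y m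
  obtain ⟨f, hf, -⟩ := hper.descends
  exact ⟨fun q => f q.1 q.2, fun y a => (congrFun (hf y) a).symm⟩

omit [NormedAlgebra ℂ 𝔸] [CompleteSpace 𝔸] in
/-- **THE BOND SIZES DESCEND TO THE TORUS**: for a `T`-periodic 1-form `A` there is `Ab` on the torus bonds with `Ab (tcls T y, ν) = ‖A(y,ν)‖`
— the hypothesis `hA` of `…OneStepCoarseCurlL2.sum_sq_coarseCurl_le`. [folklore] -/
theorem exists_bondSize_torus (hA : IsPeriodic T A) :
    ∃ Ab : (Fin d → ZMod T) × Fin d → ℝ, ∀ (y : Site d) (ν : Fin d), Ab (tcls T y, ν) = ‖A y ν‖ := by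
  obtain ⟨f, hf, -⟩ := (isPeriodic_norm_apply hA).descends
  exact ⟨fun b => f b.1 b.2, fun y ν => (congrFun (hf y) ν).symm⟩

end Descent

/-! ## §4 The two-scale torus: base points `qb y = L·y` of `(ℤ∕M)^d` in `ℤ^d` and the wrap lemma -/

section Wrap

variable (L M : ℕ) [NeZero M]
  (qb : (Fin d → ZMod M) → Site d) (hqb : ∀ y i, qb y i = (L : ℤ) * (((y i).val : ℕ) : ℤ))

include hqb in
/-- **THE TORUS NEIGHBOUR vs THE `ℤ^d` NEIGHBOUR OF A BASE POINT**: `qb(y + e_κ) = qb y + L e_κ + LM·m` with `m = −⌊(y_κ + 1)∕M⌋ e_κ` (`m = 0`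
unless `y_κ = M − 1`, where the torus wraps). [folklore] -/
theorem qb_add_single (y : Fin d → ZMod M) (κ : Fin d) :
    qb (y + Pi.single κ 1) = qb y + (L : ℤ) • e κ
      + ((L * M : ℕ) : ℤ) • (fun i => if i = κ then -((((y κ).val + 1) / M : ℕ) : ℤ) else 0) := by
  funext i
  simp only [hqb, Pi.add_apply, Pi.smul_apply, smul_eq_mul, e, Pi.single_apply]
  by_cases hi : i = κ
  · subst hi
    simp only [if_true]
    have h1 : (y i + 1).val = ((y i).val + 1) % M := by
      rw [ZMod.val_add, ZMod.val_one_eq_one_mod, Nat.add_mod_mod]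
    have h2 : ((y i).val + 1) % M + M * (((y i).val + 1) / M) = (y i).val + 1 := Nat.mod_add_div _ _
    have h3 : (((y i + 1).val : ℕ) : ℤ) + (M : ℤ) * ((((y i).val + 1) / M : ℕ) : ℤ) = (((y i).val : ℕ) : ℤ) + 1 := by
      rw [h1]; exact_mod_cast h2
    generalize ((y i).val + 1) / M = n at h3 ⊢
    push_cast
    linear_combination (L : ℤ) * h3
  · simp only [hi, if_false, mul_zero, add_zero]

include hqb in
/-- **THE WRAP LEMMA**: every `LM`-periodic `F` on `ℤ^d` reads the same at the torus neighbour `qb(y + e_κ)` and at the `ℤ^d` neighbour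
`qb y + L e_κ` of a base point — so the coarse covariant curl of `…OneStepCoarseCurlL2` (which reads `Q₀A`, `V̄₀` at `qb y + L e_κ`) is a function
of torus coarse 1-forms. [folklore] -/
theorem apply_qb_add_single {β : Type*} {F : Site d → β} (hF : IsPeriodic (L * M) F) (y : Fin d → ZMod M) (κ : Fin d) :
    F (qb (y + Pi.single κ 1)) = F (qb y + (L : ℤ) • e κ) := by
  rw [qb_add_single L M qb hqb y κ]
  exact hF _ _

omit [NeZero M] in
include hqb in
/-- the torus class of a base point: `tcls (LM) (qb y) = (y_i·L)_i`. [folklore] -/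
theorem tcls_qb (y : Fin d → ZMod M) : tcls (L * M) (qb y) = fun i => ((((y i).val * L : ℕ)) : ZMod (L * M)) := by
  funext i
  simp only [tcls_apply, hqb]
  push_cast
  ring

end Wrap

end Summit.QuantumFields.BalabanUV.T4Continuum.NE7b.OneStepAveragePeriodicity

end
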